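import Summits.BirchSwinnertonDyer.BirchSwinnertonDyer.Theorems.GenusKolyvaginAtTwoGenusPrimitiveSupplyAtTwoLoweringImageNoTwoTorsion
import HarnessLib

/-!
# Route `GenusKolyvaginAtTwo`, crux #2 `GenusPrimitiveSupplyAtTwo` (stmt-BirchSwinnertonDyer-22136):
# Mazur–Rubin 2010 Lemma 3.6 and the split twisting primes of Prop. 5.2 under the PRINTED hypothesis `E(ℚ)[2] = 0`
# (image of `ρ̄_{E,2}` = `C₃` or `S₃`), not only for `ρ̄_{E,2}` onto

Lead seat `bsd-line-gk2-p1` g8 (cell `bsd-f1-sign2`). THEOREMS ONLY (no definition, no named fact, no `sorry`); helper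
`--supports stmt-BirchSwinnertonDyer-22136`; no item is closed; BSD is not proved by any of this.

WHY. `…LoweringPrime` / `…LoweringStep` prove Mazur–Rubin 2010 Prop. 5.2 over `ℚ` for `ρ̄_{E,2}` ONTO (the crux's habitat),
through gk2-p4's image algebra (`h1_restriction_injective_two_rat`, the dichotomy), which is typed for a surjective `ρ̄₂`.
The printed proposition (route item 24950 `MazurRubinProp52Rat := MazurRubin2010.prop52_rat`) assumes only `E(ℚ)[2] = 0`, i.e.
`Gal(ℚ(E[2])/ℚ) ∈ {C₃, S₃}` («In either case `E[2]` is an irreducible `Γ`-module, and `H¹(Γ,E[2]) = 0`», MR p. 9). This file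
removes the surjectivity: everything the argument uses is ONE element of `Γ_ℚ` acting on `E[2]` WITHOUT non-zero fixed points
(a `3`-cycle), and such an element exists as soon as `E[2]` has no non-zero `Γ_ℚ`-fixed point (§1: if no element is
fixed-point-free, every element is `1` or a transposition; two transpositions with different fixed points compose to a
`3`-cycle; one common fixed point is excluded).

The companion `…LoweringImageNoTwoTorsion` supplies the image algebra under `hnt : ∀ P ∈ E[2], (∀ σ, σP = P) → P = 0` (a
fixed-point-free element, Prop. 9.1 at `2`, transitivity, dichotomy, commutator reduction) and the bridge `#E(ℚ)[2] = 1 ⟹ hnt`.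
This file: `exists_mem_h1Eval_ne_pair'` (Lemma 3.6) and **`exists_splitTwistingPrime_pair'`** (the split twisting primes of
Prop. 5.2: `ℓ ≡ 1 (mod m)`, `Frob_ℓ ∈ Γ_{ℚ(E[2])} ∩ A`, `x, y, x+y, x−y` alive at `ℓ`) under `hnt` — proofs VERBATIM from
`…LoweringPrime` (`hsurj` ↦ `hnt`).

References: [MazurRubin2010] arXiv:0904.3709: Lemma 3.6 (p. 9), Prop. 5.2 (p. 12); [GrossLMS1991] §9 Prop. 9.1, 9.6;
[LawsonWuthrich2016] Lemma 6; [SilvermanAEC2009] III.§2 Ex. 3.7, VIII.§1 (Galois descent).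
-/

set_option linter.dupNamespace false -- tree convention: `Summit.BirchSwinnertonDyer.BirchSwinnertonDyer.Theorems` (summit = sub-problem)
set_option autoImplicit false

noncomputable section

open scoped Classical Pointwise

namespace Summit.BirchSwinnertonDyer.BirchSwinnertonDyer.Theorems.GenusKolyLowering

open WeierstrassCurve NumberField IsDedekindDomain Field
open Literature.NumberTheory.GaloisRepresentations Literature.NumberTheory.EllipticCurves
open Literature.NumberTheory
open Summit.BirchSwinnertonDyer.BirchSwinnertonDyer.Theorems.GenusKolyTwistingPrime

/-! ## §3 Lemma 3.6 and the split twisting primes under `E(ℚ)[2] = 0` -/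

section Split

variable (W : WeierstrassCurve ℚ) [W.IsElliptic]

/-- **Mazur–Rubin Lemma 3.6 at `p = 2` under `E(ℚ)[2] = 0`** (as `exists_mem_h1Eval_ne_pair`, with `hsurj` replaced by `hnt`).
[cite: MazurRubin2010, Lemma 3.6 (arXiv:0904.3709 p. 9)] -/
theorem exists_mem_h1Eval_ne_pair'
    (hnt : ∀ P : geomTorsion W (2 : ℤ), (∀ σ : absoluteGaloisGroup ℚ, σ • P = P) → P = 0)
    (x y : galH1Torsion W (2 : ℤ)) (B : Subgroup (absoluteGaloisGroup ℚ))
    (hBT : B ≤ torsionFixing W (2 : ℤ))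
    (hBconj : ∀ (σ : absoluteGaloisGroup ℚ) {h : absoluteGaloisGroup ℚ}, h ∈ B → σ * h * σ⁻¹ ∈ B)
    (hx : ∃ h ∈ B, h1Eval W (2 : ℤ) x h ≠ 0) (hy : ∃ h ∈ B, h1Eval W (2 : ℤ) y h ≠ 0)
    (hxy : ∃ h ∈ B, h1Eval W (2 : ℤ) x h ≠ h1Eval W (2 : ℤ) y h) :
    ∃ t ∈ B, h1Eval W (2 : ℤ) x t ≠ 0 ∧ h1Eval W (2 : ℤ) y t ≠ 0 ∧
      h1Eval W (2 : ℤ) x t ≠ h1Eval W (2 : ℤ) y t := by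
  have honto : ∀ z : galH1Torsion W (2 : ℤ), (∃ h ∈ B, h1Eval W (2 : ℤ) z h ≠ 0) →
      ∀ P : geomTorsion W (2 : ℤ), ∃ h ∈ B, h1Eval W (2 : ℤ) z h = P := fun z hz ↦ by
    rcases forall_h1Eval_eq_zero_or_forall_exists_h1Eval_eq' W hnt z B hBT hBconj with h0 | h
    · obtain ⟨h, hhB, hh⟩ := hz
      exact absurd (h0 h hhB) hh
    · exact h
  obtain ⟨ρ₀, hρ₀B, hρ₀⟩ := hxy
  have hρ₀T : ρ₀ ∈ torsionFixing W (2 : ℤ) := hBT hρ₀B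
  have step : ∀ z₁ z₂ : galH1Torsion W (2 : ℤ), (∃ h ∈ B, h1Eval W (2 : ℤ) z₁ h ≠ 0) →
      h1Eval W (2 : ℤ) z₁ ρ₀ = 0 → h1Eval W (2 : ℤ) z₂ ρ₀ ≠ 0 →
      ∃ t ∈ B, h1Eval W (2 : ℤ) z₁ t ≠ 0 ∧ h1Eval W (2 : ℤ) z₂ t ≠ 0 ∧
        h1Eval W (2 : ℤ) z₁ t ≠ h1Eval W (2 : ℤ) z₂ t := by
    intro z₁ z₂ hz₁ ha hb
    set b := h1Eval W (2 : ℤ) z₂ ρ₀ with hb_def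
    obtain ⟨P₁, hP₁0, hP₁b⟩ := exists_geomTorsion_two_ne_ne W 0 b
    obtain ⟨ρ₁, hρ₁B, hρ₁⟩ := honto z₁ hz₁ P₁
    set d := h1Eval W (2 : ℤ) z₂ ρ₁ with hd_def
    have hmul₁ : h1Eval W (2 : ℤ) z₁ (ρ₀ * ρ₁) = P₁ := by
      rw [h1Eval_mul W _ z₁ hρ₀T, ha, hρ₁, zero_add]
    have hmul₂ : h1Eval W (2 : ℤ) z₂ (ρ₀ * ρ₁) = b + d := by
      rw [h1Eval_mul W _ z₂ hρ₀T]
    by_cases hd0 : d = 0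
    · refine ⟨ρ₀ * ρ₁, B.mul_mem hρ₀B hρ₁B, ?_, ?_, ?_⟩
      · rw [hmul₁]; exact hP₁0
      · rw [hmul₂, hd0, add_zero]; exact hb
      · rw [hmul₁, hmul₂, hd0, add_zero]; exact hP₁b
    by_cases hdP : d = P₁
    · refine ⟨ρ₀ * ρ₁, B.mul_mem hρ₀B hρ₁B, ?_, ?_, ?_⟩
      · rw [hmul₁]; exact hP₁0
      · rw [hmul₂, hdP]
        intro h
        exact hP₁b ((geomTorsion_two_add_eq_zero_iff W b P₁).mp h).symm
      · rw [hmul₁, hmul₂, hdP]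
        intro h
        exact hb (by simpa using h)
    · exact ⟨ρ₁, hρ₁B, by rw [hρ₁]; exact hP₁0, hd0, by rw [hρ₁]; exact Ne.symm hdP⟩
  by_cases ha : h1Eval W (2 : ℤ) x ρ₀ = 0
  · have hb : h1Eval W (2 : ℤ) y ρ₀ ≠ 0 := fun hb ↦ hρ₀ (by rw [ha, hb])
    exact step x y hx ha hb
  by_cases hb : h1Eval W (2 : ℤ) y ρ₀ = 0
  · obtain ⟨t, htB, h1, h2, h3⟩ := step y x hy hb ha
    exact ⟨t, htB, h2, h1, Ne.symm h3⟩
  · exact ⟨ρ₀, hρ₀B, ha, hb, hρ₀⟩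

/-- **THE SPLIT TWISTING PRIMES OF PROP. 5.2 under the printed hypothesis `E(ℚ)[2] = 0`** (as `exists_splitTwistingPrime_pair`, with
`ρ̄₂` onto replaced by «no non-zero `Γ_ℚ`-fixed point of `E[2]`»): a prime `ℓ ∉ B₀`, `ℓ ≡ 1 (mod m)`, a place `v ∋ ℓ` off `S′` with
arithmetic Frobenius `t ∈ Γ_{ℚ(E[2])} ∩ A`, `([x,t],[y,t])` a basis of `E[2]`, and `x, y, x+y, x−y` all alive in `H¹(ℚ_v, E[2])`.
Čebotarev is the tree theorem `frobenius_dense` ∘ `chebotarev_artinRep_holds`.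
[cite: MazurRubin2010, Prop. 5.2 (proof, arXiv:0904.3709 p. 12) with Lemma 3.6 (p. 9)] [cite: GrossLMS1991, §9 Prop. 9.6]
[cite: SerreAbelianLadic1968, Ch. I §2.2 (Čebotarev)] -/
theorem exists_splitTwistingPrime_pair'
    (hnt : ∀ P : geomTorsion W (2 : ℤ), (∀ σ : absoluteGaloisGroup ℚ, σ • P = P) → P = 0)
    {x y : galH1Torsion W (2 : ℤ)} (hx : x ≠ 0) (hy : y ≠ 0) (hxy : x ≠ y)
    (A : Subgroup (absoluteGaloisGroup ℚ)) (hAopen : IsOpen (A : Set (absoluteGaloisGroup ℚ)))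
    (hA : ∀ γ δ : absoluteGaloisGroup ℚ, γ * δ * γ⁻¹ * δ⁻¹ ∈ A)
    {m : ℕ} (hm : m ≠ 0) (B₀ : Finset ℕ) {S' : Set (HeightOneSpectrum (𝓞 ℚ))} (hS' : S'.Finite) :
    ∃ ℓ : ℕ, ∃ _ : Fact ℓ.Prime, ℓ ∉ B₀ ∧ ¬ ℓ ∣ m ∧ (ℓ : ℤ) ≡ 1 [ZMOD (m : ℤ)] ∧
      ∃ (v : HeightOneSpectrum (𝓞 ℚ)) (𝔓 : Ideal (absIntegers (𝓞 ℚ) ℚ)) (t : absoluteGaloisGroup ℚ),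
        v ∉ S' ∧ (ℓ : 𝓞 ℚ) ∈ v.asIdeal ∧ 𝔓 ∈ v.primesAbove ∧ IsArithFrobAt (𝓞 ℚ) t 𝔓 ∧
        t ∈ torsionFixing W (2 : ℤ) ∧ t ∈ A ∧ (∀ P : geomTorsion W (2 : ℤ), t • P = P) ∧
        h1Eval W (2 : ℤ) x t ≠ 0 ∧ h1Eval W (2 : ℤ) y t ≠ 0 ∧ h1Eval W (2 : ℤ) x t ≠ h1Eval W (2 : ℤ) y t ∧
        x ∉ W.torsionLocalKer (v.adicCompletion ℚ) (2 : ℤ) ∧ y ∉ W.torsionLocalKer (v.adicCompletion ℚ) (2 : ℤ) ∧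
        x + y ∉ W.torsionLocalKer (v.adicCompletion ℚ) (2 : ℤ) ∧
        x - y ∉ W.torsionLocalKer (v.adicCompletion ℚ) (2 : ℤ) := by
  classical
  haveI : NeZero m := ⟨hm⟩
  have hn0 : (2 : ℤ) ≠ 0 := two_ne_zero
  set T := torsionFixing W (2 : ℤ) with hTdef
  have hTopen : IsOpen (T : Set (absoluteGaloisGroup ℚ)) := isOpen_torsionFixing W hn0
  -- a primitive `m`-th root of unity
  have hq0 : ((m : ℕ) : AlgebraicClosure ℚ) ≠ 0 := by exact_mod_cast hm
  haveI : NeZero ((m : ℕ) : AlgebraicClosure ℚ) := ⟨hq0⟩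
  obtain ⟨ζ, hζ⟩ := IsAlgClosed.exists_root (Polynomial.cyclotomic m (AlgebraicClosure ℚ))
    (Polynomial.degree_cyclotomic_pos m _ (Nat.pos_of_ne_zero hm)).ne'
  have hprim : IsPrimitiveRoot ζ m := Polynomial.isRoot_cyclotomic_iff.mp hζ
  have hpow : ∀ σ : absoluteGaloisGroup ℚ, ∃ i : ℕ, σ • ζ = ζ ^ i := fun σ ↦ by
    have h1 : (σ • ζ) ^ m = 1 := by rw [← smul_pow', hprim.pow_eq_one, smul_one]
    obtain ⟨i, -, hi⟩ := hprim.eq_pow_of_pow_eq_one h1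
    exact ⟨i, hi.symm⟩
  set St : Subgroup (absoluteGaloisGroup ℚ) := MulAction.stabilizer (absoluteGaloisGroup ℚ) ζ with hSt
  have hStopen : IsOpen (St : Set (absoluteGaloisGroup ℚ)) := isOpen_stabilizer_absoluteGaloisGroup ζ
  have hStconj : ∀ (σ : absoluteGaloisGroup ℚ) {h : absoluteGaloisGroup ℚ}, h ∈ St →
      σ * h * σ⁻¹ ∈ St := by
    intro σ h hh
    change (σ * h * σ⁻¹) • ζ = ζ
    have hh' : h • ζ = ζ := hh
    obtain ⟨i, hi⟩ := hpow σ⁻¹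
    rw [mul_smul, mul_smul, hi, smul_pow', hh', ← hi, smul_inv_smul]
  -- ### abelian side conditions are free: `A' = Stab ζ ⊓ A` is commutator-closed
  set A' : Subgroup (absoluteGaloisGroup ℚ) := St ⊓ A with hA'
  have hA'comm : ∀ γ δ : absoluteGaloisGroup ℚ, γ * δ * γ⁻¹ * δ⁻¹ ∈ A' := fun γ δ ↦
    ⟨commutator_smul_rootOfUnity hprim γ δ, hA γ δ⟩
  -- ### the conjugation-stable subgroup `B = Γ_{ℚ(E[2], ζ)} ∩ A` and Lemma 3.6 on it
  set B : Subgroup (absoluteGaloisGroup ℚ) := T ⊓ A' with hB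
  have hBT : B ≤ torsionFixing W (2 : ℤ) := fun h hh ↦ hh.1
  have hBconj : ∀ (σ : absoluteGaloisGroup ℚ) {h : absoluteGaloisGroup ℚ}, h ∈ B → σ * h * σ⁻¹ ∈ B :=
    fun σ h hh ↦ ⟨(torsionFixing_normal W _).conj_mem h hh.1 σ,
      ⟨hStconj σ hh.2.1, conj_mem_of_commutator_mem hA σ hh.2.2⟩⟩
  have hmove : ∀ z : galH1Torsion W (2 : ℤ), z ≠ 0 → ∃ h ∈ B, h1Eval W (2 : ℤ) z h ≠ 0 := fun z hz ↦ by
    obtain ⟨h, hT, hA'', hh⟩ := exists_torsionFixing_mem_h1Eval_ne' W hnt hz A' hA'comm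
    exact ⟨h, ⟨hT, hA''⟩, hh⟩
  have hx' := hmove x hx
  have hy' := hmove y hy
  have hxy' : ∃ h ∈ B, h1Eval W (2 : ℤ) x h ≠ h1Eval W (2 : ℤ) y h := by
    obtain ⟨h, hhB, hh⟩ := hmove (x - y) (sub_ne_zero.mpr hxy)
    refine ⟨h, hhB, fun heq ↦ hh ?_⟩
    rw [sub_eq_add_neg, h1Eval_add W _ x (-y) (hBT hhB), h1Eval_neg W _ y (hBT hhB), heq, add_neg_cancel]
  obtain ⟨t₀, ht₀B, ht₀x, ht₀y, ht₀xy⟩ := exists_mem_h1Eval_ne_pair' W hnt x y B hBT hBconj hx' hy' hxy'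
  have ht₀T : t₀ ∈ torsionFixing W (2 : ℤ) := hBT ht₀B
  have ht₀ζ : t₀ • ζ = ζ := ht₀B.2.1
  have ht₀A : t₀ ∈ A := ht₀B.2.2
  -- ### the finite exceptional set of places of `ℚ`
  set Bx : Finset ℕ := m.primeFactors ∪ B₀ with hBx
  set S : Set (HeightOneSpectrum (𝓞 ℚ)) :=
    {v | ∃ q ∈ Bx, q.Prime ∧ (q : 𝓞 ℚ) ∈ v.asIdeal} ∪ S' with hS
  have hSfin : S.Finite := by
    refine Set.Finite.union ?_ hS'
    have : {v : HeightOneSpectrum (𝓞 ℚ) | ∃ q ∈ Bx, q.Prime ∧ (q : 𝓞 ℚ) ∈ v.asIdeal} ⊆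
        ⋃ q ∈ (Bx.filter Nat.Prime), {v | (q : 𝓞 ℚ) ∈ v.asIdeal} := by
      intro v ⟨q, hqB, hq, hqv⟩
      simp only [Set.mem_iUnion, Finset.mem_filter]
      exact ⟨q, ⟨hqB, hq⟩, hqv⟩
    refine Set.Finite.subset (Set.Finite.biUnion (Finset.finite_toSet _) fun q hq ↦ ?_) this
    rw [Finset.coe_filter, Set.mem_setOf_eq] at hq
    have hsub : {v : HeightOneSpectrum (𝓞 ℚ) | (q : 𝓞 ℚ) ∈ v.asIdeal}.Subsingleton :=
      fun v hv v' hv' ↦ HeightOneSpectrum.eq_of_natCast_mem_rat hq.2 hv hv'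
    exact hsub.finite
  -- ### Čebotarev: a Frobenius in the open set `t₀ · (𝒩 ∩ Stab ζ ∩ A)`
  set xs : Bool → galH1Torsion W (2 : ℤ) := fun i ↦ if i then x else y with hxs
  set 𝒩 := evalKer W (2 : ℤ) xs with h𝒩
  have h𝒩open : IsOpen (𝒩 : Set (absoluteGaloisGroup ℚ)) :=
    isOpen_evalKer W _ _ (isOpen_torsionFixing W hn0)
  set U : Set (absoluteGaloisGroup ℚ) := ((𝒩 : Set _) ∩ (St : Set _)) ∩ (A : Set _) with hU
  have hUopen : IsOpen U := (h𝒩open.inter hStopen).inter hAopen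
  set O : Set (absoluteGaloisGroup ℚ) := (fun γ ↦ t₀ * γ) '' U with hO
  have hOopen : IsOpen O := (Homeomorph.mulLeft t₀).isOpenMap _ hUopen
  have hOne : O.Nonempty := ⟨t₀ * 1, 1, ⟨⟨𝒩.one_mem, St.one_mem⟩, A.one_mem⟩, rfl⟩
  obtain ⟨γ, hγO, v, hvS, 𝔓₀, h𝔓₀, hγ⟩ :=
    (absoluteGaloisGroup.frobenius_dense Automorphic.chebotarev_artinRep_holds ℚ S hSfin
      ).inter_open_nonempty O hOopen hOne
  obtain ⟨u, ⟨⟨hu𝒩, huSt⟩, huA⟩, rfl⟩ := hγO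
  have huT : u ∈ torsionFixing W (2 : ℤ) := hu𝒩.1
  have hux : h1Eval W (2 : ℤ) x u = 0 := by simpa [hxs] using hu𝒩.2 true
  have huy : h1Eval W (2 : ℤ) y u = 0 := by simpa [hxs] using hu𝒩.2 false
  have huζ : u • ζ = ζ := huSt
  set t := t₀ * u with ht
  have htT : t ∈ torsionFixing W (2 : ℤ) := mul_mem ht₀T huT
  have htA : t ∈ A := mul_mem ht₀A huA
  have hvS' : v ∉ S' := fun h ↦ hvS (Or.inr h)
  -- ### the rational prime `ℓ` under `v`
  set ℓ : ℕ := (Rat.HeightOneSpectrum.primesEquiv (R := 𝓞 ℚ) v : ℕ) with hℓdef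
  have hℓ : ℓ.Prime := (Rat.HeightOneSpectrum.primesEquiv (R := 𝓞 ℚ) v).2
  haveI hℓF : Fact ℓ.Prime := ⟨hℓ⟩
  have hℓv : (ℓ : 𝓞 ℚ) ∈ v.asIdeal := by
    have h := (Rat.HeightOneSpectrum.natGenerator_dvd_iff (R := 𝓞 ℚ) v (n := ℓ)).mp dvd_rfl
    rw [Ideal.mem_map_iff_of_surjective _ (Rat.IsIntegralClosure.intEquiv (𝓞 ℚ)).surjective] at h
    obtain ⟨z, hz, hzℓ⟩ := h
    have : z = (ℓ : 𝓞 ℚ) :=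
      (Rat.IsIntegralClosure.intEquiv (𝓞 ℚ)).injective (by rw [hzℓ, map_natCast])
    rwa [this] at hz
  have hℓB : ℓ ∉ Bx := fun h ↦ hvS (Or.inl ⟨ℓ, h, hℓ, hℓv⟩)
  simp only [hBx, Finset.mem_union, Nat.mem_primeFactors, not_or] at hℓB
  obtain ⟨hℓm', hℓB₀⟩ := hℓB
  have hℓm : ¬ ℓ ∣ m := fun h ↦ hℓm' ⟨hℓ, h, hm⟩
  -- ### `ℓ ≡ 1 (mod m)`: the Frobenius fixes `ζ` and raises it to the `ℓ`-th power
  have hmv : (m : 𝓞 ℚ) ∉ v.asIdeal := natCast_not_mem_of_not_dvd hℓ hℓv hℓm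
  have h1 : (t₀ * u) • ζ = ζ := by rw [mul_smul, huζ, ht₀ζ]
  have h2 : (t₀ * u) • ζ = ζ ^ v.residueCard :=
    smul_eq_pow_residueCard_of_isArithFrobAt_of_pow_eq_one hmv h𝔓₀ hγ hprim.pow_eq_one
  rw [residueCard_eq_of_natCast_mem_rat hℓ hℓv, h1] at h2
  have hζ0 : ζ ≠ 0 := hprim.ne_zero hm
  have hℓ1 : 1 ≤ ℓ := hℓ.one_lt.le
  have hζ1 : ζ ^ (ℓ - 1) = 1 := by
    have h3 : ζ ^ (ℓ - 1) * ζ = 1 * ζ := by rw [← pow_succ, Nat.sub_add_cancel hℓ1, ← h2, one_mul]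
    exact mul_right_cancel₀ hζ0 h3
  have hmdvd : m ∣ ℓ - 1 := (hprim.pow_eq_one_iff_dvd (ℓ - 1)).mp hζ1
  have hmod : (ℓ : ℤ) ≡ 1 [ZMOD (m : ℤ)] := by
    have h := Int.natCast_dvd_natCast.mpr hmdvd
    rw [Nat.cast_sub hℓ1, Nat.cast_one] at h
    exact (Int.modEq_iff_dvd.mpr h).symm
  -- ### values of the classes at `t`
  have hfix : ∀ P : geomTorsion W (2 : ℤ), t • P = P := fun P ↦ smul_eq_of_mem_torsionFixing W _ htT P
  have hxt : h1Eval W (2 : ℤ) x t = h1Eval W (2 : ℤ) x t₀ := by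
    rw [ht, h1Eval_mul W _ x ht₀T, hux, add_zero]
  have hyt : h1Eval W (2 : ℤ) y t = h1Eval W (2 : ℤ) y t₀ := by
    rw [ht, h1Eval_mul W _ y ht₀T, huy, add_zero]
  have hvx : h1Eval W (2 : ℤ) x t ≠ 0 := by rw [hxt]; exact ht₀x
  have hvy : h1Eval W (2 : ℤ) y t ≠ 0 := by rw [hyt]; exact ht₀y
  have hvxy : h1Eval W (2 : ℤ) x t ≠ h1Eval W (2 : ℤ) y t := by rw [hxt, hyt]; exact ht₀xy
  have hvadd : h1Eval W (2 : ℤ) (x + y) t ≠ 0 := by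
    rw [h1Eval_add W _ x y htT]
    exact fun h ↦ hvxy ((geomTorsion_two_add_eq_zero_iff W _ _).mp h)
  have hvsub : h1Eval W (2 : ℤ) (x - y) t ≠ 0 := by
    rw [sub_eq_add_neg, h1Eval_add W _ x (-y) htT, h1Eval_neg W _ y htT, ← sub_eq_add_neg]
    exact sub_ne_zero.mpr hvxy
  -- ### the local criterion at `v`
  have hloc : ∀ z : galH1Torsion W (2 : ℤ), h1Eval W (2 : ℤ) z t ≠ 0 →
      z ∉ W.torsionLocalKer (v.adicCompletion ℚ) (2 : ℤ) := fun z hz ↦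
    not_mem_torsionLocalKer_of_h1Eval_frob_ne_zero W (n := 2) two_ne_zero h𝔓₀ hγ htT hz
  exact ⟨ℓ, hℓF, hℓB₀, hℓm, hmod, v, 𝔓₀, t, hvS', hℓv, h𝔓₀, hγ, htT, htA, hfix, hvx, hvy, hvxy,
    hloc x hvx, hloc y hvy, hloc (x + y) hvadd, hloc (x - y) hvsub⟩

end Split

end Summit.BirchSwinnertonDyer.BirchSwinnertonDyer.Theorems.GenusKolyLowering

end
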